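import Literature.AlgebraicGeometry.Resolution.AffineBlowupAlgebra
import Mathlib.Algebra.Polynomial.Laurent
import Mathlib.RingTheory.Localization.Ideal
import Mathlib.RingTheory.Polynomial.Basic
import HarnessLib

/-!
# The localized Rees algebra `R[It]_{at}` is the chart ring `R[I/a]` with a Laurent variable:
# `R[It]_{at} = R[I/a][X]_X`, `X ↦ at` (the cone over a chart of a blowing up)

Topic: `Literature/AlgebraicGeometry/Resolution`. For an ideal `I` of a commutative ring `R` and
`a ∈ I`, the chart `D₊(at) = Spec C` of the blowing up `Bl_I(Spec R) = Proj R[It]`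
(`AffineBlowup.lean`) has coordinate ring the degree-zero localization `C = (R[It])_{(at)} = R[I/a]`
(Stacks 0804). The FULL localization `L = R[It]_{at}` is `C` with the homogeneous unit `at` of degree
one adjoined: the `C`-algebra map `θ : C[X] → L`, `X ↦ at`, identifies `L` with the localization
`C[X]_X = C[X, X⁻¹]` (EGA II (2.2.1): "`S_f` est isomorphe à `S_{(f)}[T, T⁻¹]`" for `f` homogeneous of
degree one). This is the algebra behind "the exceptional divisor of `Bl_I(X)` is `Proj` of the normal
cone", read chartwise: under `θ`, the extension `𝔯 L` of an ideal `𝔯 ⊆ C` (a point of the chart)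
is the extension of `𝔯[X]`, so `𝔯 L` is prime when `𝔯` is and `𝔯 L ∩ C = 𝔯`; pulled back to
`R[It]` it is the homogeneous prime of the cone corresponding to the point `𝔯` of the chart.
Everything here is PROVED; it is used by `FibreConePermissibleBlowup*.lean` (the Hilbert–Samuel
inequality for permissible blow-ups, CJS 2020 Thm. 3.10 (1), via the cone over the fibre).

* `reesComponent b d` — the degree-`d` homogeneous component `b_d t^d` of `b ∈ R[It]`;
  `sum_reesComponent`;
* `awayCoeff a ha b d = b_d t^d/(at)^d ∈ C`, `awayPoly a ha b = Σ_d (b_d t^d/(at)^d) X^d ∈ C[X]`,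
  `awayPolyHom a ha = θ : C[X] →+* L` with **`θ (awayPoly b) = b/1`** (`awayPolyHom_awayPoly`);
* **`awayPolyHom_injective`** — `θ` is injective (seen in `R[1/a][T, T⁻¹]`, where `x tⁿ/(at)ⁿ ↦ x/aⁿ`
  is the injective chart map `reesChart` (`reesChart_injective`, `AffineBlowupAlgebra.lean`) and
  `at ↦ aT`);
* **`isLocalization_awayPoly`** — `L` is the localization of `C[X]` at the powers of `X` (for the
  algebra structure `awayPolyAlgebra = θ`);
* `isPrime_map_away`, `under_map_away`, `map_away_le_iff`, `mem_comap_map_away_iff`,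
  `comap_map_away_le_iff` — for a prime `𝔯` of `C`: `𝔯 L` is prime, `𝔯 L ∩ C = 𝔯`,
  `𝔯 L ⊆ 𝔯' L ↔ 𝔯 ⊆ 𝔯'`, and `b ∈ R[It]` lies in `𝔯 L` iff all its coefficients `b_d t^d/(at)^d` lie
  in `𝔯` (so the contraction of `𝔯 L` to `R[It]` is a homogeneous prime whose degree-zero part is
  `φ⁻¹(𝔯) ⊆ R`, `algebraMap_mem_comap_map_away_iff`, and which does not contain `at`,
  `reesT_notMem_comap_map_away`); `reesConstCoeff` — the augmentation `R[It] → R`.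

No definitions of mathematical objects beyond these explicit polynomials/maps; no named facts are
introduced.

## Sources

* A. Grothendieck, J. Dieudonné, EGA II, (2.2.1)–(2.2.3) (the structure of `S_f` over `S_{(f)}`);
  The Stacks Project, Tag 0804 (charts of a blowing up), Tag 00JM. [StacksProject]
* V. Cossart, U. Jannsen, S. Saito, LNM 2270 (2020), proof of Thm. 3.10 (p. 46: the fibre of the
  blow-up is `Proj` of the graded algebra `A = gr_𝔭(𝒪) ⊗ k(x)`). [CossartJannsenSaito2020]
-/

noncomputable section

open Polynomial HomogeneousLocalization

namespace Literature.AlgebraicGeometry.Resolution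

universe u

variable {R : Type u} [CommRing R] {I : Ideal R}

/-! ## Homogeneous components of elements of the Rees algebra -/

/-- The degree-`d` homogeneous component `b_d t^d` of `b ∈ R[It] ⊆ R[t]`. [folklore] -/
def reesComponent (b : reesAlgebra I) (d : ℕ) : reesAlgebra I :=
  ⟨monomial d ((b : R[X]).coeff d), reesAlgebra.monomial_mem.mpr (b.2 d)⟩

/-- Underlying polynomial of a component. [folklore] -/
@[simp] theorem coe_reesComponent (b : reesAlgebra I) (d : ℕ) :
    (reesComponent b d : R[X]) = monomial d ((b : R[X]).coeff d) := rfl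

/-- Components are homogeneous. [folklore] -/
theorem reesComponent_mem (b : reesAlgebra I) (d : ℕ) : reesComponent b d ∈ reesGrading I d :=
  ⟨_, rfl⟩

/-- Components are homogeneous (degree written `d • 1`, the form `HomogeneousLocalization.Away.mk`
wants for a denominator of degree one). [folklore] -/
theorem reesComponent_mem' (b : reesAlgebra I) (d : ℕ) : reesComponent b d ∈ reesGrading I (d • 1) := by
  rw [smul_eq_mul, mul_one]; exact reesComponent_mem b d

/-- `b` is the sum of its components. [folklore] -/
theorem sum_reesComponent (b : reesAlgebra I) :
    ∑ d ∈ (b : R[X]).support, reesComponent b d = b := by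
  apply Subtype.ext
  rw [AddSubmonoidClass.coe_finsetSum]
  exact ((b : R[X]).as_sum_support).symm

/-- A component with vanishing coefficient is zero. [folklore] -/
theorem reesComponent_eq_zero {b : reesAlgebra I} {d : ℕ} (h : (b : R[X]).coeff d = 0) :
    reesComponent b d = 0 :=
  Subtype.ext (by simp [h])

/-- The constant coefficient `R[It] → R`, `b ↦ b_0` (a ring homomorphism: the augmentation of the
Rees algebra onto its degree-zero part). [folklore] -/
def reesConstCoeff (I : Ideal R) : reesAlgebra I →+* R :=
  (Polynomial.constantCoeff : R[X] →+* R).comp (reesAlgebra I).val.toRingHom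

/-- Unfolding. [folklore] -/
@[simp] theorem reesConstCoeff_apply (b : reesAlgebra I) :
    reesConstCoeff I b = (b : R[X]).coeff 0 := rfl

/-- The augmentation is the identity on `R ⊆ R[It]`. [folklore] -/
@[simp] theorem reesConstCoeff_algebraMap (r : R) :
    reesConstCoeff I (algebraMap R (reesAlgebra I) r) = r := by
  rw [reesConstCoeff_apply, Subalgebra.coe_algebraMap, Polynomial.algebraMap_eq, coeff_C_zero]

/-- The augmentation is surjective. [folklore] -/
theorem reesConstCoeff_surjective : Function.Surjective (reesConstCoeff I) :=
  fun r => ⟨algebraMap R (reesAlgebra I) r, reesConstCoeff_algebraMap r⟩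

section Away

variable (a : R) (ha : a ∈ I)

local notation3 "𝒞" => HomogeneousLocalization.Away (reesGrading I) (reesT a ha)
local notation3 "𝓛" => Localization.Away (reesT a ha)
-- the structure maps, bundled (elaboration aid)
local notation3 "ιC" => (algebraMap (HomogeneousLocalization.Away (reesGrading I) (reesT a ha))
  (Localization.Away (reesT a ha)) :
    HomogeneousLocalization.Away (reesGrading I) (reesT a ha) →+* Localization.Away (reesT a ha))
local notation3 "ιR" => (algebraMap (reesAlgebra I) (Localization.Away (reesT a ha)) :
    reesAlgebra I →+* Localization.Away (reesT a ha))
local notation3 "ιP" => (algebraMap (Polynomial (HomogeneousLocalization.Away (reesGrading I) (reesT a ha)))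
  (Localization.Away (reesT a ha)) :
    Polynomial (HomogeneousLocalization.Away (reesGrading I) (reesT a ha)) →+* Localization.Away (reesT a ha))

/-! ## The coefficients `b_d t^d/(at)^d ∈ C` and the polynomial `Σ_d (b_d t^d/(at)^d) X^d` -/

/-- The coefficient `b_d t^d/(at)^d ∈ C = (R[It])_{(at)}` of `b ∈ R[It]`. [folklore] -/
def awayCoeff (b : reesAlgebra I) (d : ℕ) : 𝒞 :=
  HomogeneousLocalization.Away.mk (reesGrading I) (reesT_mem a ha) d (reesComponent b d)
    (reesComponent_mem' b d)

/-- Its value in `L = R[It]_{at}`. [folklore] -/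
theorem val_awayCoeff (b : reesAlgebra I) (d : ℕ) :
    (awayCoeff a ha b d).val =
      Localization.mk (reesComponent b d) (⟨reesT a ha ^ d, d, rfl⟩ : Submonoid.powers (reesT a ha)) :=
  HomogeneousLocalization.Away.val_mk _ _ _ _ _

/-- `C → L` is `val` (a `rfl` lemma with the types fixed, for rewriting). [folklore] -/
theorem algebraMap_away_eq_val (c : 𝒞) : ιC c = c.val := rfl

/-- A vanishing coefficient of `b` gives a vanishing `awayCoeff`. [folklore] -/
theorem awayCoeff_eq_zero {b : reesAlgebra I} {d : ℕ} (h : (b : R[X]).coeff d = 0) :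
    awayCoeff a ha b d = 0 := by
  apply HomogeneousLocalization.val_injective
  rw [val_awayCoeff, reesComponent_eq_zero h, Localization.mk_zero, HomogeneousLocalization.val_zero]

/-- In degree zero the coefficient is `b_0/1 = φ(b_0)` for the structure map
`φ = reesChartBase : R → C`. [folklore] -/
theorem awayCoeff_zero (b : reesAlgebra I) :
    awayCoeff a ha b 0 = reesChartBase a ha ((b : R[X]).coeff 0) := by
  apply HomogeneousLocalization.val_injective
  rw [val_awayCoeff, val_reesChartBase_eq_mk]
  have h1 : reesComponent b 0 = algebraMap R (reesAlgebra I) ((b : R[X]).coeff 0) :=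
    Subtype.ext (by rw [coe_reesComponent, Subalgebra.coe_algebraMap, Polynomial.algebraMap_eq,
      monomial_zero_left])
  have h2 : (⟨reesT a ha ^ 0, 0, rfl⟩ : Submonoid.powers (reesT a ha)) = 1 := Subtype.ext (pow_zero _)
  rw [h1, h2]

/-- **`(b_d t^d/(at)^d) · (at)^d = b_d t^d` in `L`.** [folklore] -/
theorem algebraMap_awayCoeff_mul_pow (b : reesAlgebra I) (d : ℕ) :
    ιC (awayCoeff a ha b d) * ιR (reesT a ha) ^ d =
      ιR (reesComponent b d) := by
  rw [algebraMap_away_eq_val, val_awayCoeff, Localization.mk_eq_mk', ← map_pow]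
  exact IsLocalization.mk'_spec 𝓛 (reesComponent b d)
    (⟨reesT a ha ^ d, d, rfl⟩ : Submonoid.powers (reesT a ha))

/-- The polynomial `Σ_d (b_d t^d/(at)^d) X^d ∈ C[X]` of `b ∈ R[It]`. [folklore] -/
def awayPoly (b : reesAlgebra I) : Polynomial 𝒞 :=
  ∑ d ∈ (b : R[X]).support, C (awayCoeff a ha b d) * X ^ d

/-- Its coefficients. [folklore] -/
theorem coeff_awayPoly (b : reesAlgebra I) (n : ℕ) : (awayPoly a ha b).coeff n = awayCoeff a ha b n := by
  classical
  rw [awayPoly, finsetSum_coeff]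
  simp only [coeff_C_mul, coeff_X_pow, mul_ite, mul_one, mul_zero]
  rw [Finset.sum_ite_eq]
  split_ifs with h
  · rfl
  · rw [awayCoeff_eq_zero a ha (Polynomial.notMem_support_iff.mp h)]

/-! ## `θ : C[X] → L`, `X ↦ at` -/

/-- **The `C`-algebra map `θ : C[X] → L = R[It]_{at}`, `X ↦ at`.** [cite: StacksProject, Tag 0804] -/
def awayPolyHom : Polynomial 𝒞 →+* 𝓛 :=
  Polynomial.eval₂RingHom ιC (ιR (reesT a ha))

/-- `θ` on constants. [folklore] -/
@[simp] theorem awayPolyHom_C (c : 𝒞) : awayPolyHom a ha (C c) = ιC c :=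
  Polynomial.eval₂_C _ _

/-- `θ X = at`. [folklore] -/
@[simp] theorem awayPolyHom_X : awayPolyHom a ha X = ιR (reesT a ha) :=
  Polynomial.eval₂_X _ _

/-- **`θ (Σ_d (b_d t^d/(at)^d) X^d) = b/1`**: every element of `R[It]` becomes, in `L`, a
polynomial in `at` with coefficients in the chart ring. [cite: StacksProject, Tag 0804] -/
theorem awayPolyHom_awayPoly (b : reesAlgebra I) :
    awayPolyHom a ha (awayPoly a ha b) = ιR b := by
  conv_rhs => rw [← sum_reesComponent b, map_sum]
  simp only [awayPoly, map_sum, map_mul, map_pow, awayPolyHom_C, awayPolyHom_X,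
    algebraMap_awayCoeff_mul_pow]

/-- Every element of `L` is `θ(p)/(at)ⁿ` for a polynomial `p ∈ C[X]`. [folklore] -/
theorem exists_mul_pow_eq_awayPolyHom (z : 𝓛) :
    ∃ (n : ℕ) (p : Polynomial 𝒞),
      z * ιR (reesT a ha) ^ n = awayPolyHom a ha p := by
  obtain ⟨⟨b, ⟨_, n, rfl⟩⟩, h⟩ := IsLocalization.surj (Submonoid.powers (reesT a ha)) z
  exact ⟨n, awayPoly a ha b, by rw [← map_pow, h, awayPolyHom_awayPoly]⟩

/-! ## Injectivity of `θ`, through `R[1/a][T, T⁻¹]` -/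

/-- `R[It] ⊆ R[t] → R[1/a][T, T⁻¹]`, `t ↦ T`. [folklore] -/
def reesLaurent : reesAlgebra I →+* LaurentPolynomial (Localization.Away a) :=
  (Polynomial.toLaurent : (Localization.Away a)[X] →+* _).comp
    ((Polynomial.mapRingHom (algebraMap R (Localization.Away a))).comp (reesAlgebra I).val.toRingHom)

/-- On a homogeneous element `r tⁿ`: `reesLaurent (r tⁿ) = (r/1) Tⁿ`. [folklore] -/
theorem reesLaurent_of_coe_eq {b : reesAlgebra I} {n : ℕ} {r : R} (h : (b : R[X]) = monomial n r) :
    reesLaurent a b =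
      LaurentPolynomial.C (algebraMap R (Localization.Away a) r) * LaurentPolynomial.T n := by
  change Polynomial.toLaurent (Polynomial.map (algebraMap R (Localization.Away a)) (b : R[X])) = _
  rw [h, Polynomial.map_monomial, Polynomial.toLaurent_C_mul_T]

/-- `reesLaurent (at) = (a/1) T`, a unit. [folklore] -/
theorem reesLaurent_reesT :
    reesLaurent a (reesT a ha) =
      LaurentPolynomial.C (algebraMap R (Localization.Away a) a) * LaurentPolynomial.T 1 := by
  rw [reesLaurent_of_coe_eq a (coe_reesT a ha), Nat.cast_one]

/-- `(a/1) T` is a unit of `R[1/a][T, T⁻¹]`. [folklore] -/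
theorem isUnit_reesLaurent_reesT : IsUnit (reesLaurent a (reesT a ha)) := by
  rw [reesLaurent_reesT]
  exact ((IsLocalization.Away.algebraMap_isUnit a).map LaurentPolynomial.C).mul
    (LaurentPolynomial.isUnit_T 1)

/-- `ρ : L = R[It]_{at} → R[1/a][T, T⁻¹]`, the extension of `reesLaurent`. [folklore] -/
def awayLaurent : 𝓛 →+* LaurentPolynomial (Localization.Away a) :=
  IsLocalization.Away.lift (reesT a ha) (g := reesLaurent a) (isUnit_reesLaurent_reesT a ha)

/-- `ρ (b/1) = reesLaurent b`. [folklore] -/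
theorem awayLaurent_algebraMap (b : reesAlgebra I) :
    awayLaurent a ha (ιR b) = reesLaurent a b :=
  IsLocalization.Away.lift_eq _ _ _

/-- **`ρ` restricted to the chart ring is the chart map**: `ρ(c) = reesChart(c) ∈ R[1/a]`
(constants of the Laurent polynomial ring), since `ρ(x tⁿ/(at)ⁿ) = (x/1)Tⁿ · ((a/1)T)⁻ⁿ = x/aⁿ`.
[cite: StacksProject, Tag 0804] -/
theorem awayLaurent_algebraMap_away (c : 𝒞) :
    awayLaurent a ha (ιC c) = LaurentPolynomial.C (reesChart a ha c) := by
  obtain ⟨n, x, hx, rfl⟩ := HomogeneousLocalization.Away.mk_surjective (reesGrading I) (reesT_mem a ha) c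
  obtain ⟨r, hr⟩ := id hx
  have hr' : (x : R[X]) = monomial n r := by
    rw [smul_eq_mul, mul_one] at hr
    exact hr.symm
  -- the unit `((a/1) T)^n`
  have hu : IsUnit (reesLaurent a (reesT a ha) ^ n) := (isUnit_reesLaurent_reesT a ha).pow n
  refine (hu.mul_left_inj).mp ?_
  -- left: `ρ(x tⁿ/(at)ⁿ) · ρ((at)ⁿ) = ρ(x tⁿ) = (r/1) Tⁿ`
  have hval : (HomogeneousLocalization.Away.mk (reesGrading I) (reesT_mem a ha) n x hx).val *
      ιR (reesT a ha) ^ n = ιR x := by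
    rw [HomogeneousLocalization.Away.val_mk, Localization.mk_eq_mk', ← map_pow]
    exact IsLocalization.mk'_spec 𝓛 x (⟨reesT a ha ^ n, n, rfl⟩ : Submonoid.powers (reesT a ha))
  have h1 : awayLaurent a ha (ιC
      (HomogeneousLocalization.Away.mk (reesGrading I) (reesT_mem a ha) n x hx)) *
      reesLaurent a (reesT a ha) ^ n = reesLaurent a x := by
    rw [← awayLaurent_algebraMap a ha (reesT a ha), ← map_pow, ← map_mul,
      algebraMap_away_eq_val, hval, awayLaurent_algebraMap]
  -- right: `reesChart(c) · aⁿ = r/1`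
  have h2 : reesChart a ha (HomogeneousLocalization.Away.mk (reesGrading I) (reesT_mem a ha) n x hx) *
      algebraMap R (Localization.Away a) a ^ n = algebraMap R (Localization.Away a) r := by
    rw [reesChart_mk_mul_pow, reesEval_of_eq_monomial a hr']
  rw [h1, reesLaurent_of_coe_eq a hr', reesLaurent_reesT, mul_pow, ← map_pow, ← mul_assoc,
    ← map_mul, h2, LaurentPolynomial.T_pow, mul_one]

/-- The composite `Ψ = ρ ∘ θ : C[X] → R[1/a][T, T⁻¹]` on `C c Xᵈ`: `reesChart(c) (a/1)ᵈ Tᵈ`.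
[folklore] -/
theorem awayLaurent_awayPolyHom_C_mul_X_pow (c : 𝒞) (d : ℕ) :
    awayLaurent a ha (awayPolyHom a ha (C c * X ^ d)) =
      AddMonoidAlgebra.single (d : ℤ) (reesChart a ha c * algebraMap R (Localization.Away a) a ^ d) := by
  rw [map_mul, map_pow, awayPolyHom_C, awayPolyHom_X, map_mul, map_pow,
    awayLaurent_algebraMap_away, awayLaurent_algebraMap, reesLaurent_reesT, mul_pow, ← map_pow,
    ← mul_assoc, ← map_mul, LaurentPolynomial.T_pow, mul_one, LaurentPolynomial.single_eq_C_mul_T]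

/-- The `e`-th Laurent coefficient of `Ψ(p)` is `reesChart(p_e) (a/1)ᵉ`. [folklore] -/
theorem awayLaurent_awayPolyHom_apply (p : Polynomial 𝒞) (e : ℕ) :
    (awayLaurent a ha (awayPolyHom a ha p)).coeff (e : ℤ) =
      reesChart a ha (p.coeff e) * algebraMap R (Localization.Away a) a ^ e := by
  classical
  conv_lhs => rw [p.as_sum_support_C_mul_X_pow, map_sum, map_sum]
  simp only [awayLaurent_awayPolyHom_C_mul_X_pow]
  rw [AddMonoidAlgebra.coeff_sum, Finsupp.finsetSum_apply]
  simp only [AddMonoidAlgebra.coeff_single, Finsupp.single_apply, Nat.cast_inj]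
  rw [Finset.sum_ite_eq']
  split_ifs with h
  · rfl
  · rw [Polynomial.notMem_support_iff.mp h, map_zero, zero_mul]

/-- **`θ : C[X] → L` is injective.** [cite: StacksProject, Tag 0804] -/
theorem awayPolyHom_injective : Function.Injective (awayPolyHom a ha) := by
  rw [injective_iff_map_eq_zero]
  intro p hp
  refine Polynomial.ext fun e => ?_
  rw [Polynomial.coeff_zero]
  have h := awayLaurent_awayPolyHom_apply a ha p e
  rw [hp, map_zero, AddMonoidAlgebra.coeff_zero, Finsupp.zero_apply] at h
  have hu : IsUnit (algebraMap R (Localization.Away a) a ^ e) :=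
    (IsLocalization.Away.algebraMap_isUnit a).pow e
  have h0 : reesChart a ha (p.coeff e) = 0 := by
    rw [eq_comm, hu.mul_left_eq_zero] at h
    exact h
  exact reesChart_injective a ha (by rw [h0, map_zero])

/-! ## `L` is the localization `C[X]_X` -/

/-- The `C[X]`-algebra structure on `L` given by `θ` (`X ↦ at`). [folklore] -/
@[reducible] def awayPolyAlgebra : Algebra (Polynomial 𝒞) 𝓛 := (awayPolyHom a ha).toAlgebra

attribute [local instance] awayPolyAlgebra

/-- Unfolding the algebra map. [folklore] -/
theorem algebraMap_awayPolyAlgebra (p : Polynomial 𝒞) :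
    ιP p = awayPolyHom a ha p := rfl

/-- `C → C[X] → L` is `C → L`. [folklore] -/
instance isScalarTower_awayPolyAlgebra : IsScalarTower 𝒞 (Polynomial 𝒞) 𝓛 :=
  IsScalarTower.of_algebraMap_eq fun c => by
    rw [algebraMap_awayPolyAlgebra, Polynomial.algebraMap_eq, awayPolyHom_C]

/-- **`L = R[It]_{at}` is the localization of `C[X]` at the powers of `X`** (EGA II (2.2.1):
`S_f ≅ S_{(f)}[T, T⁻¹]` for `f` homogeneous of degree one). [cite: StacksProject, Tag 0804] -/
theorem isLocalization_awayPoly : IsLocalization.Away (X : Polynomial 𝒞) 𝓛 where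
  map_units := by
    rintro ⟨_, n, rfl⟩
    rw [algebraMap_awayPolyAlgebra, map_pow, awayPolyHom_X]
    exact (IsLocalization.Away.algebraMap_isUnit (reesT a ha)).pow n
  surj z := by
    obtain ⟨n, p, h⟩ := exists_mul_pow_eq_awayPolyHom a ha z
    refine ⟨⟨p, ⟨X ^ n, n, rfl⟩⟩, ?_⟩
    change z * ιP (X ^ n) = ιP p
    rw [algebraMap_awayPolyAlgebra, algebraMap_awayPolyAlgebra, map_pow, awayPolyHom_X]
    exact h
  exists_of_eq {p q} h := ⟨1, by rw [awayPolyHom_injective a ha h]⟩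

/-! ## Extensions of ideals of the chart ring to `L` -/

/-- `X` meets no extended ideal `𝔯[X]` of a proper ideal `𝔯 ⊆ C`. [folklore] -/
theorem disjoint_powers_X_map_C {𝔯 : Ideal 𝒞} (h𝔯 : 𝔯 ≠ ⊤) :
    Disjoint (Submonoid.powers (X : Polynomial 𝒞) : Set (Polynomial 𝒞)) (𝔯.map Polynomial.C) := by
  rw [Set.disjoint_left]
  rintro _ ⟨n, rfl⟩ hX
  have h := (Ideal.mem_map_C_iff.mp hX) n
  rw [coeff_X_pow, if_pos rfl] at h
  exact h𝔯 ((Ideal.eq_top_iff_one _).mpr h)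

/-- `𝔯[X] ∩ C = 𝔯`. [folklore] -/
theorem comap_C_map_C (𝔯 : Ideal 𝒞) : (𝔯.map (Polynomial.C : 𝒞 →+* Polynomial 𝒞)).comap Polynomial.C = 𝔯 := by
  refine le_antisymm (fun c hc => ?_) Ideal.le_comap_map
  have h := (Ideal.mem_map_C_iff.mp (Ideal.mem_comap.mp hc)) 0
  rwa [coeff_C_zero] at h

/-- `𝔯 L = (𝔯[X]) L` under `θ`. [folklore] -/
theorem map_away_eq_map_map (𝔯 : Ideal 𝒞) :
    𝔯.map (ιC) =
      (𝔯.map (Polynomial.C : 𝒞 →+* Polynomial 𝒞)).map (ιP) := by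
  rw [Ideal.map_map, IsScalarTower.algebraMap_eq 𝒞 (Polynomial 𝒞) 𝓛, Polynomial.algebraMap_eq]

/-- **`𝔯 L` is prime for a prime `𝔯` of the chart ring** (`L/𝔯L = (C/𝔯)[X]_X`).
[cite: StacksProject, Tag 0804] -/
theorem isPrime_map_away (𝔯 : Ideal 𝒞) [𝔯.IsPrime] : (𝔯.map (ιC)).IsPrime := by
  haveI := isLocalization_awayPoly a ha
  rw [map_away_eq_map_map]
  exact IsLocalization.isPrime_of_isPrime_disjoint (Submonoid.powers (X : Polynomial 𝒞)) 𝓛 _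
    (Ideal.isPrime_map_C_of_isPrime) (disjoint_powers_X_map_C a ha (Ideal.IsPrime.ne_top inferInstance))

/-- `(𝔯 L) ∩ C[X] = 𝔯[X]`. [folklore] -/
theorem comap_awayPolyHom_map_away (𝔯 : Ideal 𝒞) [𝔯.IsPrime] :
    (𝔯.map (ιC)).comap (ιP) = 𝔯.map Polynomial.C := by
  haveI := isLocalization_awayPoly a ha
  rw [map_away_eq_map_map]
  exact IsLocalization.under_map_of_isPrime_disjoint (Submonoid.powers (X : Polynomial 𝒞)) 𝓛
    (Ideal.isPrime_map_C_of_isPrime) (disjoint_powers_X_map_C a ha (Ideal.IsPrime.ne_top inferInstance))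

/-- **`(𝔯 L) ∩ C = 𝔯`** for a prime `𝔯` of the chart ring. [cite: StacksProject, Tag 0804] -/
theorem under_map_away (𝔯 : Ideal 𝒞) [𝔯.IsPrime] : (𝔯.map (ιC)).comap (ιC) = 𝔯 := by
  rw [show (𝔯.map ιC).comap ιC = ((𝔯.map ιC).comap ιP).comap (algebraMap 𝒞 (Polynomial 𝒞)) by
        rw [Ideal.comap_comap, ← IsScalarTower.algebraMap_eq],
    comap_awayPolyHom_map_away, Polynomial.algebraMap_eq, comap_C_map_C]

/-- `𝔯 L ⊆ 𝔯' L ↔ 𝔯 ⊆ 𝔯'` for primes of the chart ring. [folklore] -/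
theorem map_away_le_iff {𝔯 𝔯' : Ideal 𝒞} [𝔯.IsPrime] [𝔯'.IsPrime] :
    𝔯.map (ιC) ≤ 𝔯'.map (ιC) ↔ 𝔯 ≤ 𝔯' := by
  refine ⟨fun h => ?_, fun h => Ideal.map_mono h⟩
  rw [← under_map_away a ha 𝔯, ← under_map_away a ha 𝔯']
  exact Ideal.comap_mono h

/-- A polynomial `p ∈ C[X]` has `θ(p) ∈ 𝔯 L` iff all its coefficients lie in `𝔯`. [folklore] -/
theorem awayPolyHom_mem_map_away_iff (𝔯 : Ideal 𝒞) [𝔯.IsPrime] (p : Polynomial 𝒞) :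
    awayPolyHom a ha p ∈ 𝔯.map (ιC) ↔ ∀ n, p.coeff n ∈ 𝔯 := by
  rw [← Ideal.mem_map_C_iff, ← comap_awayPolyHom_map_away a ha 𝔯, Ideal.mem_comap,
    algebraMap_awayPolyAlgebra]

/-- **Homogeneity of the cone's primes**: `b ∈ R[It]` lies in `𝔯 L` iff every coefficient
`b_d t^d/(at)^d` lies in `𝔯`. [cite: StacksProject, Tag 0804] -/
theorem mem_comap_map_away_iff (𝔯 : Ideal 𝒞) [𝔯.IsPrime] (b : reesAlgebra I) :
    b ∈ (𝔯.map (ιC)).comap (ιR) ↔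
      ∀ d, awayCoeff a ha b d ∈ 𝔯 := by
  rw [Ideal.mem_comap, ← awayPolyHom_awayPoly, awayPolyHom_mem_map_away_iff]
  simp only [coeff_awayPoly]

/-- In particular an element of `R ⊆ R[It]` lies in `𝔯 L` iff `φ(r) = r/1 ∈ 𝔯`. [folklore] -/
theorem algebraMap_mem_comap_map_away_iff (𝔯 : Ideal 𝒞) [𝔯.IsPrime] (r : R) :
    algebraMap R (reesAlgebra I) r ∈ (𝔯.map (ιC)).comap (ιR) ↔
      reesChartBase a ha r ∈ 𝔯 := by
  rw [mem_comap_map_away_iff]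
  have hc : ∀ d, ((algebraMap R (reesAlgebra I) r : reesAlgebra I) : R[X]).coeff d =
      if d = 0 then r else 0 := fun d => by
    rw [Subalgebra.coe_algebraMap, Polynomial.algebraMap_eq, coeff_C]
  constructor
  · intro h
    have h0 := h 0
    rwa [awayCoeff_zero, hc, if_pos rfl] at h0
  · intro h d
    by_cases hd : d = 0
    · subst hd; rwa [awayCoeff_zero, hc, if_pos rfl]
    · rw [awayCoeff_eq_zero a ha (by rw [hc, if_neg hd])]
      exact zero_mem _

/-- The degree-zero part of the contraction of `𝔯 L` to `R[It]`: `b ∈ 𝔯L ⇒ φ(b_0) ∈ 𝔯`. [folklore] -/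
theorem reesChartBase_coeff_zero_mem_of_mem_comap_map_away (𝔯 : Ideal 𝒞) [𝔯.IsPrime]
    {b : reesAlgebra I} (hb : b ∈ (𝔯.map (ιC)).comap (ιR)) :
    reesChartBase a ha ((b : R[X]).coeff 0) ∈ 𝔯 := by
  rw [← awayCoeff_zero]
  exact (mem_comap_map_away_iff a ha 𝔯 b).mp hb 0

/-- `at ∉ 𝔯 L` (it is a unit of `L`). [folklore] -/
theorem reesT_notMem_comap_map_away (𝔯 : Ideal 𝒞) [𝔯.IsPrime] :
    reesT a ha ∉ (𝔯.map (ιC)).comap (ιR) := by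
  haveI := isPrime_map_away a ha 𝔯
  intro h
  exact (Ideal.IsPrime.ne_top inferInstance) (Ideal.eq_top_of_isUnit_mem _ (Ideal.mem_comap.mp h)
    (IsLocalization.Away.algebraMap_isUnit (reesT a ha)))

/-- The contractions to `R[It]` are ordered like the primes of the chart:
`(𝔯 L) ∩ R[It] ⊆ (𝔯' L) ∩ R[It] ↔ 𝔯 ⊆ 𝔯'`. [folklore] -/
theorem comap_map_away_le_iff {𝔯 𝔯' : Ideal 𝒞} [𝔯.IsPrime] [𝔯'.IsPrime] :
    (𝔯.map (ιC)).comap (ιR) ≤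
        (𝔯'.map (ιC)).comap (ιR) ↔ 𝔯 ≤ 𝔯' := by
  refine ⟨fun h => ?_, fun h => Ideal.comap_mono (Ideal.map_mono h)⟩
  have h' := Ideal.map_mono (f := ιR) h
  rw [← Ideal.under_def, ← Ideal.under_def,
    IsLocalization.map_under (Submonoid.powers (reesT a ha)) 𝓛,
    IsLocalization.map_under (Submonoid.powers (reesT a ha)) 𝓛] at h'
  exact (map_away_le_iff a ha).mp h'

end Away

end Literature.AlgebraicGeometry.Resolution

end
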